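import Literature.Probability.Percolation.ChainTailBound
import HarnessLib

/-!
# The comparison chain over blocks of consecutive levels: a binomial lower bound

Grimmett–Manolescu, *Bond percolation on isoradial graphs* (PTRF 159 (2014) 273–327 =
arXiv:1204.0505), §6.3, proof of Proposition 6.8 from Lemma 6.9: the comparison chain `X_j` of
the vertical transport moves at most once per block `V_k` of `N` track exchanges (the levels
exchanged within a block increase one by one, so that after its one possible move the chain is
below all later levels of the block), whence over the blocks it is the random walk
"`H^k = H^0 + Σ_{i ≤ k} Δ_i`, `P(Δ = 0) = 2δ`, `P(Δ = -1) = 1 - 2δ`" of (6.31), and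
"`(H^k)` is a random walk with mean step-size `2δ - 1`. By the law of large numbers,
`c_N = P(H^N ≥ δN | H^0 ≥ N) → 1` as `N → ∞`. In addition, `c_N > 0`, and (6.31) follows."

This file proves the corresponding facts for the tail function `tailF` of
`Literature.Probability.Percolation.ChainTailBound`:

* `RandomMapChain.tailF_range'_map` — **block reduction**: along a block of levels
  `L, L+1, …, L+n-1` the chain at `m` makes exactly one `θ`-step if `L ≤ m < L + n` and none
  otherwise; `RandomMapChain.binF` — the tail of `m - Binomial(j, 1-θ)` (recursion over blocks) and
  `binF_le_tailF` — over `K` such blocks, `tailF ≥ binF K` (using the monotonicity of `tailF`);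
* `RandomMapChain.binPmf` — the binomial weights by their recursion, `sum_binPmf` (total mass `1`),
  `sum_mul_binPmf` (mean `n q`), and the Markov bound `sum_filter_binPmf_le` on the upper tail;
* **`RandomMapChain.half_theta_le_binF`** — for `0 < θ ≤ 1` and `u ≤ θN/2`, `binF θ u N N ≥ θ/2`
  (a crude but `N`-uniform substitute for `c_N → 1`, which is all that box-crossing estimates
  use), and **`half_theta_le_tailF`**, the same for `tailF` over `N` blocks of `n` consecutive
  levels each.

## References

* G. R. Grimmett, I. Manolescu, PTRF 159 (2014) 273–327, arXiv:1204.0505, §6.3 ((6.31) and the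
  chain `X_j` at the end of the proof of Lemma 6.9).
-/

noncomputable section

namespace Literature.Probability.Percolation

namespace RandomMapChain

open Finset

/-! ### Block reduction -/

/-- **Block reduction**: along a block of consecutive levels `ℓ (a + s) = L + s` (`s < n`) followed
by `rest`, the comparison chain at `m` makes one `θ`-step if `L ≤ m < L + n`, and is unchanged
otherwise (after its step it is below all later levels of the block). [cite: GrimmettManolescu2014Isoradial, §6.3] -/
theorem tailF_range'_map (θ : ℝ) (u : ℕ) (ℓ : ℕ → ℕ) : ∀ (n a L : ℕ) (rest : List ℕ) (m : ℕ),
    (∀ s, s < n → ℓ (a + s) = L + s) →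
    tailF θ u ((List.range' a n).map ℓ ++ rest) m =
      if L ≤ m ∧ m < L + n then θ * tailF θ u rest m + (1 - θ) * tailF θ u rest (m - 1) else tailF θ u rest m
  | 0, a, L, rest, m, _ => by simp
  | n + 1, a, L, rest, m, h => by
    have h0 : ℓ a = L := by simpa using h 0 (Nat.zero_lt_succ n)
    have ih := tailF_range'_map θ u ℓ n (a + 1) (L + 1) rest
    have h' : ∀ s, s < n → ℓ (a + 1 + s) = L + 1 + s := fun s hs => by
      have := h (s + 1) (by omega); rw [show a + (s + 1) = a + 1 + s by ring] at this; omega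
    rw [List.range'_succ, List.map_cons, List.cons_append, tailF, h0]
    by_cases hm : m = L
    · subst hm
      rw [if_pos rfl, ih m h', ih (m - 1) h', if_neg (by omega), if_neg (by omega), if_pos (by omega)]
    · rw [if_neg hm, ih m h']
      by_cases hr : L + 1 ≤ m ∧ m < L + 1 + n
      · rw [if_pos hr, if_pos (by omega)]
      · rw [if_neg hr, if_neg (by omega)]

/-- Block reduction, inequality form (valid for every `m`). [cite: GrimmettManolescu2014Isoradial, §6.3] -/
theorem mix_le_tailF_range'_map {θ : ℝ} (hθ0 : 0 ≤ θ) (hθ1 : θ ≤ 1) (u : ℕ) (ℓ : ℕ → ℕ) (n a L : ℕ)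
    (rest : List ℕ) (m : ℕ) (h : ∀ s, s < n → ℓ (a + s) = L + s) :
    θ * tailF θ u rest m + (1 - θ) * tailF θ u rest (m - 1) ≤ tailF θ u ((List.range' a n).map ℓ ++ rest) m := by
  rw [tailF_range'_map θ u ℓ n a L rest m h]
  split_ifs
  · exact le_rfl
  · have := tailF_le_of_le hθ0 hθ1 u rest (Nat.sub_le m 1)
    nlinarith

/-- **The tail over `j` blocks** of the chain that makes one `θ`-step per block: the tail of
`m - Binomial(j, 1 - θ)` at `u` (GM14 (6.31): `H^k = H^0 + Σ Δ_i`). [cite: GrimmettManolescu2014Isoradial, §6.3 (6.31)] -/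
def binF (θ : ℝ) (u : ℕ) : ℕ → ℕ → ℝ
  | 0, m => if u ≤ m then 1 else 0
  | j + 1, m => θ * binF θ u j m + (1 - θ) * binF θ u j (m - 1)

/-- **Over `K` blocks of `n` consecutive levels each, `tailF ≥ binF K`.** [cite: GrimmettManolescu2014Isoradial, §6.3] -/
theorem binF_le_tailF {θ : ℝ} (hθ0 : 0 ≤ θ) (hθ1 : θ ≤ 1) (u n : ℕ) : ∀ (K : ℕ) (ℓ : ℕ → ℕ) (L : ℕ → ℕ),
    (∀ k, k < K → ∀ s, s < n → ℓ (k * n + s) = L k + s) → ∀ m,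
    binF θ u K m ≤ tailF θ u ((List.range (K * n)).map ℓ) m
  | 0, ℓ, L, _, m => by simp [binF, tailF]
  | K + 1, ℓ, L, h, m => by
    -- the first block, then the remaining `K` blocks for the shifted levels
    have hsplit : (List.range ((K + 1) * n)).map ℓ =
        (List.range' 0 n).map ℓ ++ (List.range (K * n)).map (fun t => ℓ (n + t)) := by
      have e1 : List.range ((K + 1) * n) = List.range' 0 n ++ List.range' n (K * n) := by
        rw [show (K + 1) * n = n + K * n by ring, List.range_eq_range', ← List.range'_append]
        simp
      have e2 : ((List.range (K * n)).map fun t => n + t) = List.range' n (K * n) := by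
        rw [List.range_eq_range', List.map_add_range', Nat.add_zero]
      rw [e1, List.map_append, ← e2, List.map_map]
      rfl
    have ih := binF_le_tailF hθ0 hθ1 u n K (fun t => ℓ (n + t)) (fun k => L (k + 1)) (fun k hk s hs => by
      have := h (k + 1) (by omega) s hs
      rw [show (k + 1) * n + s = n + (k * n + s) by ring] at this
      exact this)
    rw [hsplit, binF]
    refine le_trans ?_ (mix_le_tailF_range'_map hθ0 hθ1 u ℓ n 0 (L 0) _ m fun s hs => by simpa using h 0 (by omega) s hs)
    have h1 := ih m
    have h2 := ih (m - 1)
    nlinarith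

/-- `binF` is between `0` and `1`. [folklore] -/
theorem binF_mem_Icc {θ : ℝ} (hθ0 : 0 ≤ θ) (hθ1 : θ ≤ 1) (u : ℕ) : ∀ (j m : ℕ), binF θ u j m ∈ Set.Icc (0 : ℝ) 1
  | 0, m => by unfold binF; split_ifs <;> norm_num
  | j + 1, m => by
    unfold binF
    have h1 := binF_mem_Icc hθ0 hθ1 u j m
    have h2 := binF_mem_Icc hθ0 hθ1 u j (m - 1)
    constructor <;> nlinarith [h1.1, h1.2, h2.1, h2.2]

/-! ### The binomial weights -/

/-- The binomial weights `P(Binomial(n, q) = i)`, by their recursion. [folklore] -/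
def binPmf (q : ℝ) : ℕ → ℕ → ℝ
  | 0, i => if i = 0 then 1 else 0
  | n + 1, i => (1 - q) * binPmf q n i + q * (if i = 0 then 0 else binPmf q n (i - 1))

/-- The binomial weights are nonnegative. [folklore] -/
theorem binPmf_nonneg {q : ℝ} (hq0 : 0 ≤ q) (hq1 : q ≤ 1) : ∀ (n i : ℕ), 0 ≤ binPmf q n i
  | 0, i => by unfold binPmf; split_ifs <;> norm_num
  | n + 1, i => by
    unfold binPmf
    have h1 := binPmf_nonneg hq0 hq1 n i
    split_ifs
    · nlinarith
    · have h2 := binPmf_nonneg hq0 hq1 n (i - 1); nlinarith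

/-- The binomial weights vanish above `n`. [folklore] -/
theorem binPmf_eq_zero {q : ℝ} : ∀ {n i : ℕ}, n < i → binPmf q n i = 0
  | 0, i, h => by unfold binPmf; rw [if_neg (by omega)]
  | n + 1, i, h => by
    unfold binPmf
    rw [binPmf_eq_zero (by omega : n < i), if_neg (by omega), binPmf_eq_zero (by omega : n < i - 1)]
    ring

/-- **Total mass one**: `∑_{i ≤ n} P(Bin = i) = 1`. [folklore] -/
theorem sum_binPmf (q : ℝ) : ∀ n : ℕ, ∑ i ∈ range (n + 1), binPmf q n i = 1
  | 0 => by simp [binPmf]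
  | n + 1 => by
    have ih := sum_binPmf q n
    have hsplit : ∑ i ∈ range (n + 2), binPmf q (n + 1) i =
        (1 - q) * ∑ i ∈ range (n + 2), binPmf q n i + q * ∑ i ∈ range (n + 2), (if i = 0 then 0 else binPmf q n (i - 1)) := by
      rw [mul_sum, mul_sum, ← sum_add_distrib]
      refine sum_congr rfl fun i _ => ?_
      simp only [binPmf]
    have h1 : ∑ i ∈ range (n + 2), binPmf q n i = 1 := by
      rw [sum_range_succ, ih, binPmf_eq_zero (by omega : n < n + 1), add_zero]
    have h2 : ∑ i ∈ range (n + 2), (if i = 0 then (0 : ℝ) else binPmf q n (i - 1)) = 1 := by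
      rw [sum_range_succ', if_pos rfl, add_zero]
      simp only [Nat.succ_ne_zero, if_false, Nat.add_sub_cancel]
      exact ih
    rw [hsplit, h1, h2]; ring

/-- **Mean `n q`**: `∑_{i ≤ n} i · P(Bin = i) = n q`. [folklore] -/
theorem sum_mul_binPmf (q : ℝ) : ∀ n : ℕ, ∑ i ∈ range (n + 1), (i : ℝ) * binPmf q n i = n * q
  | 0 => by simp [binPmf]
  | n + 1 => by
    have ih := sum_mul_binPmf q n
    have hmass := sum_binPmf q n
    have hsplit : ∑ i ∈ range (n + 2), (i : ℝ) * binPmf q (n + 1) i =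
        (1 - q) * ∑ i ∈ range (n + 2), (i : ℝ) * binPmf q n i +
          q * ∑ i ∈ range (n + 2), (i : ℝ) * (if i = 0 then 0 else binPmf q n (i - 1)) := by
      rw [mul_sum, mul_sum, ← sum_add_distrib]
      refine sum_congr rfl fun i _ => ?_
      simp only [binPmf]; ring
    have h1 : ∑ i ∈ range (n + 2), (i : ℝ) * binPmf q n i = n * q := by
      rw [sum_range_succ, ih, binPmf_eq_zero (by omega : n < n + 1), mul_zero, add_zero]
    have h2 : ∑ i ∈ range (n + 2), (i : ℝ) * (if i = 0 then (0 : ℝ) else binPmf q n (i - 1)) = n * q + 1 := by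
      rw [sum_range_succ', if_pos rfl, mul_zero, add_zero]
      simp only [Nat.succ_ne_zero, if_false, Nat.add_sub_cancel]
      have : ∀ i ∈ range (n + 1), (((i + 1 : ℕ) : ℝ)) * binPmf q n i = (i : ℝ) * binPmf q n i + binPmf q n i := by
        intro i _; push_cast; ring
      rw [sum_congr rfl this, sum_add_distrib, ih, hmass]
    rw [hsplit, h1, h2]; push_cast; ring

/-- **Markov's inequality for the upper tail**: `r · ∑_{i ≥ r} P(Bin = i) ≤ n q`. [folklore] -/
theorem mul_sum_filter_binPmf_le {q : ℝ} (hq0 : 0 ≤ q) (hq1 : q ≤ 1) (n r : ℕ) :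
    (r : ℝ) * ∑ i ∈ (range (n + 1)).filter (fun i => r ≤ i), binPmf q n i ≤ n * q := by
  have hnn := binPmf_nonneg hq0 hq1 n
  calc (r : ℝ) * ∑ i ∈ (range (n + 1)).filter (fun i => r ≤ i), binPmf q n i
      = ∑ i ∈ (range (n + 1)).filter (fun i => r ≤ i), (r : ℝ) * binPmf q n i := by rw [mul_sum]
    _ ≤ ∑ i ∈ (range (n + 1)).filter (fun i => r ≤ i), (i : ℝ) * binPmf q n i := by
        refine sum_le_sum fun i hi => ?_
        have hri : r ≤ i := (mem_filter.1 hi).2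
        exact mul_le_mul_of_nonneg_right (by exact_mod_cast hri) (hnn i)
    _ ≤ ∑ i ∈ range (n + 1), (i : ℝ) * binPmf q n i :=
        sum_le_sum_of_subset_of_nonneg (filter_subset _ _) fun i _ _ => mul_nonneg (Nat.cast_nonneg _) (hnn i)
    _ = n * q := sum_mul_binPmf q n

/-! ### `binF` against the binomial weights, and the lower bound -/

/-- **`binF j m` dominates the lower tail of `Binomial(j, 1 - θ)` at `m - u`**:
`∑_{i : i + u ≤ m} P(Bin(j, 1-θ) = i) ≤ binF θ u j m` (equality but for the reflection of the
chain at `0`). [folklore] -/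
theorem sum_filter_binPmf_le_binF {θ : ℝ} (hθ0 : 0 ≤ θ) (hθ1 : θ ≤ 1) (u : ℕ) :
    ∀ (j m : ℕ), ∑ i ∈ (range (j + 1)).filter (fun i => i + u ≤ m), binPmf (1 - θ) j i ≤ binF θ u j m
  | 0, m => by
    have hq0 : 0 ≤ 1 - θ := by linarith
    have hq1 : 1 - θ ≤ 1 := by linarith
    simp only [zero_add, binF]
    by_cases hu : u ≤ m
    · rw [if_pos hu]
      calc ∑ i ∈ (range 1).filter (fun i => i + u ≤ m), binPmf (1 - θ) 0 i
          ≤ ∑ i ∈ range 1, binPmf (1 - θ) 0 i :=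
            sum_le_sum_of_subset_of_nonneg (filter_subset _ _) fun i _ _ => binPmf_nonneg hq0 hq1 0 i
        _ = 1 := sum_binPmf _ 0
    · rw [if_neg hu]
      have : (range 1).filter (fun i => i + u ≤ m) = ∅ := by
        ext i; simp only [mem_filter, mem_range, Nat.lt_one_iff, notMem_empty, iff_false, not_and]; omega
      rw [this, sum_empty]
  | j + 1, m => by
    have hq0 : 0 ≤ 1 - θ := by linarith
    have hq1 : 1 - θ ≤ 1 := by linarith
    have hnn := binPmf_nonneg hq0 hq1 j
    have ih1 := sum_filter_binPmf_le_binF hθ0 hθ1 u j m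
    have ih2 := sum_filter_binPmf_le_binF hθ0 hθ1 u j (m - 1)
    rw [binF]
    -- split the weights of `Bin(j+1)` by the last trial
    have hsplit : ∑ i ∈ (range (j + 2)).filter (fun i => i + u ≤ m), binPmf (1 - θ) (j + 1) i =
        θ * ∑ i ∈ (range (j + 2)).filter (fun i => i + u ≤ m), binPmf (1 - θ) j i +
          (1 - θ) * ∑ i ∈ (range (j + 2)).filter (fun i => i + u ≤ m), (if i = 0 then 0 else binPmf (1 - θ) j (i - 1)) := by
      rw [mul_sum, mul_sum, ← sum_add_distrib]
      refine sum_congr rfl fun i _ => ?_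
      simp only [binPmf]; ring
    rw [hsplit]
    have hA : ∑ i ∈ (range (j + 2)).filter (fun i => i + u ≤ m), binPmf (1 - θ) j i ≤ binF θ u j m := by
      refine le_trans (le_of_eq ?_) ih1
      rw [sum_filter, sum_filter, sum_range_succ, binPmf_eq_zero (by omega : j < j + 1)]
      simp
    have hB : ∑ i ∈ (range (j + 2)).filter (fun i => i + u ≤ m), (if i = 0 then (0 : ℝ) else binPmf (1 - θ) j (i - 1)) ≤
        binF θ u j (m - 1) := by
      refine le_trans ?_ ih2
      rw [sum_filter, sum_filter, sum_range_succ']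
      have h0 : (if 0 + u ≤ m then (if (0 : ℕ) = 0 then (0 : ℝ) else binPmf (1 - θ) j (0 - 1)) else 0) = 0 := by
        simp
      rw [h0, add_zero]
      refine sum_le_sum fun i _ => ?_
      simp only [Nat.succ_ne_zero, if_false, Nat.add_sub_cancel]
      by_cases h1 : i + 1 + u ≤ m
      · rw [if_pos h1, if_pos (by omega)]
      · rw [if_neg h1]; split_ifs
        · exact hnn i
        · exact le_rfl
    nlinarith

/-- **The lower bound over `N` blocks, from the top** (GM14: "`c_N > 0`"): for `0 < θ ≤ 1` and
`u ≤ θN/2`, `binF θ u N N ≥ θ/2`. Proof: `binF θ u N N ≥ P(Bin(N, 1-θ) ≤ N - u) =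
1 - P(Bin ≥ N - u + 1) ≥ 1 - N(1-θ)/(N - u + 1)` (Markov), and `N - u + 1 ≥ (1 - θ/2)N`.
[cite: GrimmettManolescu2014Isoradial, §6.3 (6.31)] -/
theorem half_theta_le_binF {θ : ℝ} (hθ0 : 0 < θ) (hθ1 : θ ≤ 1) {N u : ℕ} (hu : (u : ℝ) ≤ θ * N / 2) :
    θ / 2 ≤ binF θ u N N := by
  have hq0 : 0 ≤ 1 - θ := by linarith
  have hq1 : 1 - θ ≤ 1 := by linarith
  have hnn := binPmf_nonneg hq0 hq1 N
  refine le_trans ?_ (sum_filter_binPmf_le_binF hθ0.le hθ1 u N N)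
  -- the lower tail is the total mass minus the upper tail
  set r := N - u + 1 with hr
  have huN : u ≤ N := by
    have : (u : ℝ) ≤ N := hu.trans (by nlinarith [Nat.cast_nonneg (α := ℝ) N])
    exact_mod_cast this
  have hcompl : ∑ i ∈ (range (N + 1)).filter (fun i => i + u ≤ N), binPmf (1 - θ) N i =
      1 - ∑ i ∈ (range (N + 1)).filter (fun i => r ≤ i), binPmf (1 - θ) N i := by
    have htot := sum_binPmf (1 - θ) N
    have hdisj : Disjoint ((range (N + 1)).filter (fun i => i + u ≤ N)) ((range (N + 1)).filter (fun i => r ≤ i)) := by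
      rw [disjoint_filter]; intro i _ h1 h2; omega
    have hunion : (range (N + 1)).filter (fun i => i + u ≤ N) ∪ (range (N + 1)).filter (fun i => r ≤ i) = range (N + 1) := by
      ext i
      simp only [mem_union, mem_filter, mem_range]
      omega
    have h2 := sum_union hdisj (f := fun i => binPmf (1 - θ) N i)
    rw [hunion, htot] at h2
    linarith
  rw [hcompl]
  -- Markov bound on the upper tail
  have hmarkov := mul_sum_filter_binPmf_le hq0 hq1 N r
  have hrpos : (0 : ℝ) < r := by rw [hr]; positivity
  have hrge : (1 - θ / 2) * N ≤ (r : ℝ) := by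
    rw [hr]; push_cast [Nat.cast_sub huN]; nlinarith
  have htail : ∑ i ∈ (range (N + 1)).filter (fun i => r ≤ i), binPmf (1 - θ) N i ≤ (1 - θ) / (1 - θ / 2) := by
    by_cases hN : N = 0
    · subst hN
      have : (range 1).filter (fun i => r ≤ i) = ∅ := by
        ext i; simp only [mem_filter, mem_range, Nat.lt_one_iff, notMem_empty, iff_false, not_and]; rw [hr]; omega
      rw [this, sum_empty]
      exact div_nonneg hq0 (by linarith)
    have hNpos : (0 : ℝ) < N := by exact_mod_cast Nat.pos_of_ne_zero hN
    rw [le_div_iff₀ (by linarith)]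
    set S := ∑ i ∈ (range (N + 1)).filter (fun i => r ≤ i), binPmf (1 - θ) N i with hSdef
    have h1 : (r : ℝ) * S ≤ N * (1 - θ) := hmarkov
    have hS : 0 ≤ S := sum_nonneg fun i _ => hnn i
    have h2 : (N : ℝ) * ((1 - θ / 2) * S) ≤ N * (1 - θ) := by nlinarith [mul_le_mul_of_nonneg_right hrge hS]
    have h3 : (1 - θ / 2) * S ≤ 1 - θ := le_of_mul_le_mul_left h2 hNpos
    linarith
  have key : θ / 2 ≤ 1 - (1 - θ) / (1 - θ / 2) := by
    have h2 : 0 < 1 - θ / 2 := by linarith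
    have : (1 - θ) / (1 - θ / 2) ≤ 1 - θ / 2 := by rw [div_le_iff₀ h2]; nlinarith
    linarith
  linarith

/-- **The comparison chain started at the top of `N` blocks of `n` consecutive levels keeps height
`θN/2` with probability at least `θ/2`**: `θ/2 ≤ tailF θ u [levels] N` for `u ≤ θN/2`, the
levels being `ℓ (k n + s) = L_k + s` (`k < N`, `s < n`). [cite: GrimmettManolescu2014Isoradial, §6.3 (6.31)] -/
theorem half_theta_le_tailF {θ : ℝ} (hθ0 : 0 < θ) (hθ1 : θ ≤ 1) {N n u : ℕ} (ℓ L : ℕ → ℕ)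
    (hℓ : ∀ k, k < N → ∀ s, s < n → ℓ (k * n + s) = L k + s) (hu : (u : ℝ) ≤ θ * N / 2) :
    θ / 2 ≤ tailF θ u ((List.range (N * n)).map ℓ) N :=
  (half_theta_le_binF hθ0 hθ1 hu).trans (binF_le_tailF hθ0.le hθ1 u n N ℓ L hℓ N)

end RandomMapChain

end Literature.Probability.Percolation
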